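import Summits.Schanuel.Schanuel.Theorems.RootDecomp1KSkelCell09

/-!
# RootDecomp1KSkelCell — lens 1, generations 43–44 «THE QUALITY-ONLY CLASS SkelLiouville ⊋ LogLogLiouville AND ITS CERTIFIED MEMBER ρ⋆» (PRICE K-α L2033, CLAIM L2045, ACK L2046; (α) PROPER of the 1K wall map): the location-free class `SkelLiouville ρ := ∀ m ∃ r, m ≤ den r ∧ ρ ≠ r ∧ |ρ − r| < den^{−m·ι(den)}` (ι q = least N with q ≤ 2^{N!}) with `LogLogLiouville ⊊ SkelLiouville ⊆ Liouville` PROVED, the member ρ⋆ = Σ_j 2^{−2^{e_j}} (FREDHOLM SERIES WITH DELETED BLOCKS) certified HYPOTHESIS-FREE in Skel ∖ (LogLog ∪ FactorialGap), the SKEL engine + extraction, the walls (1, ℓ₂, ρ) mod hNW / π-twins and the pair (ℓ₂, ρ) HYPOTHESIS-FREE for every ρ ∈ Skel, the items APPLIED at z⋆ with all binders discharged, the m = 1 ceiling, and §9 hNW DISCHARGED BY NAME on the e-wall via the Literature proof module — continuation (RootDecomp1KSkelCell10): §8 fixed-multiple ladder and the m = 1 ceiling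

(lens-1 g43/g44 HOME kernel SkelCell.lean EDITION 2 b7163857…, 2822 l, imports tree RootDecomp1KGapCell01 (+ for §9 only Literature ExpOneTranscendenceMeasureProofs); CLAIM L2045, ACK L2046 (CHECKLIST K-α (1)–(8) + the constant-dependence line of L2085 (R4)), NODE L2132 / REQUEST L2133, critic VERDICT L2140 (crit g9: CLEARED — ONE CELL credit (K-α); lens-1 tally credits ×11 + THEOREM; PORT GO in substance 01–0k `--supports stmt-Schanuel-33364`, the two scoped heartbeat raises flagged for the port record, addendum D as RootDecomp1KNWMeasureHolds GO LOW); port by census-1 gen 18 as `RootDecomp1KSkelCell01`–`11` along K's sections: 01 = §1 `iota`, `SkelLiouville`, inclusions `SkelLiouville.liouville` / `logLogLiouville_skelLiouville`; 02 = §5a anchors `aI`/`sI` + §5b the skeleton `eS`, positions `cS`, terms `aS` (up to `summable_aS`); 03 = §5b the member `rhoStar`, truncations `tS`/`rS`, bounds + §6 covering / quality lemmas; 04 = §6 THE MEMBER THEOREMS `skelLiouville_rhoStar`, `not_logLogLiouville_rhoStar`, `not_factorialGapLiouville_rhoStar`, `liouville_rhoStar`, `not_skelLiouville_subset_logLogLiouville`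 + §2 engine preliminaries (`SkelMeasure`, `exists_scale_index_iota`); 05 = §2 THE ENGINE `skelMeasure_cons_liouvilleNumber` (scoped `maxHeartbeats 800000` as in K) + `SkelMeasure.mvWeakMeasure`; 06 = §3 EXTRACTION `no_int_relation_of_skelMeasure_skelLiouville`, `sb_of_skelLiouville_of_skelMeasure`; 07 = §4 THE CELLS (pair hyp-free, walls mod hNW, π-twins) + the live items in item shape; 08 = §7 three interlaced cuts `deletedBlock_margins`, `form_lower_bound_S` (scoped `maxHeartbeats 1600000`); 09 = §7b member tuples zS2/zS3/zS3pi, scope certificates, items AT the members; 10 = §8 the fixed-multiple ladder and the m = 1 ceiling (`uStar`, `skel_fixedOne_ceiling`); 11 = §9 hNW DISCHARGED BY NAME (imports Literature ExpOneTranscendenceMeasureProofs).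
PORT EDITS: `set_option linter.dupNamespace false` dropped; the Literature import moved from the head to part 11 (the only user); K's 13 private helpers travel as per-part private copies; two generic helpers made `private` after the dedup bounce of 02 (p829539: `two_mul_le_two_pow` ≡ Literature.NumberTheory.EllipticCurves.two_mul_le_two_pow; also `log_two_lt_self` pre-emptively) and of 03 (p829791: `one_le_loglog` ≡ Literature Tao2016.EntropyDecrement.one_le_log_log; then nine more generic arithmetic helpers privatised pre-emptively: loglog_pow_pow_ge, add_factorial_mul_le_factorial_add, one_lt_ell2, partialSum_two_two, five_fourths_le_partialSum, ell2_lt, psNumer_two_cast, two_pow_lt_psNumer); and of 07 (p830787: the read-back `sb_logLogWall3_via_skel` ≡ tree `RootDecomp1KLogLogCell.sb_logLogCell` → private; in §9 likewise `nwMeasure_holds` and `sb_logLogWall3_via_skel'`, whose statements coincide with the census port RootDecomp1KNWMeasureHolds — `nwMeasure_holds` / `polyMeasure_exp_one_holds` / `sb_logLogCell'` there); and of 09 (p831465: the gate's dedup lint equates `algebraicIndependent_ell2_rhoStar : AlgebraicIndependent ℚ ![ℓ₂, ρ⋆]` with GapCell06's `algebraicIndependent_ell2_rhoW` (same shape, different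 member constant) — made `private` to pass; the public pair certificates `linearIndependent_zS2` / `sb_zS2` / `coordLiouvilleSchanuel_at_zS2` carry the content); statements and proofs verbatim. `--supports stmt-Schanuel-33364`; no census credit carried; rung 0 — nothing here proves Schanuel.)
-/

open Summit.Schanuel.Schanuel.Theorems.RootDecomp1KHyper
open Summit.Schanuel.Schanuel.Theorems.RootDecomp1KHyper.HyperCell
open Summit.Schanuel.Schanuel.Theorems.RootDecomp1KGeneric
open Summit.Schanuel.Schanuel.Theorems.RootDecomp1KRelLiouvilleCell
open Summit.Schanuel.Schanuel.Theorems.RootDecomp1KLogLogCell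
open Summit.Schanuel.Schanuel.Theorems.RootDecomp1KTwoBaseCell
open Summit.Schanuel.Schanuel.Theorems.RootDecomp1KGapCell
open LiouvilleNumber
open scoped Nat

namespace Summit.Schanuel.Schanuel.Theorems.RootDecomp1KSkelCell

/-! ## §8  THE FIXED-MULTIPLE LADDER `Skel = ⋂ₘ Skel₍ₘ₎` AND THE `m = 1` CEILING
(tightness lemma — honesty equipment, no credit; the fixed multiple `m ≥ 2` is OPEN) -/

section Ceiling

/-- Skel-Liouville at a FIXED multiple `m`: rationals of arbitrarily large denominator with
`|ρ − r| < den^{−m·ι(den)}`. -/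
def SkelLiouvilleFix (m : ℕ) (ρ : ℝ) : Prop :=
  ∀ q₀ : ℕ, ∃ r : ℚ, q₀ ≤ r.den ∧ ρ ≠ r ∧ |ρ - r| < 1 / (r.den : ℝ) ^ (m * iota r.den)

/-- `Skel = ⋂ₘ Skel₍ₘ₎` (the engine of §2–§3 consumes the whole intersection, i.e. `m → ∞`). -/
theorem skelLiouville_iff_fix (ρ : ℝ) : SkelLiouville ρ ↔ ∀ m, SkelLiouvilleFix m ρ := by
  constructor
  · intro h m q₀
    obtain ⟨r, hden, hne, hlt⟩ := h (max m q₀)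
    refine ⟨r, le_trans (le_max_right _ _) hden, hne, hlt.trans_le ?_⟩
    have h1 : (1 : ℝ) ≤ r.den := by exact_mod_cast r.den_pos
    exact one_div_le_one_div_of_le (by positivity)
      (pow_le_pow_right₀ h1 (Nat.mul_le_mul_right _ (le_max_left _ _)))
  · intro h m
    obtain ⟨r, hden, hne, hlt⟩ := h m m
    exact ⟨r, hden, hne, hlt⟩

/-- `Skel₍ₘ₊₁₎ ⊆ Skel₍ₘ₎`. -/
theorem SkelLiouvilleFix.mono {m m' : ℕ} (hmm : m ≤ m') {ρ : ℝ} (h : SkelLiouvilleFix m' ρ) :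
    SkelLiouvilleFix m ρ := by
  intro q₀
  obtain ⟨r, hden, hne, hlt⟩ := h q₀
  refine ⟨r, hden, hne, hlt.trans_le ?_⟩
  have h1 : (1 : ℝ) ≤ r.den := by exact_mod_cast r.den_pos
  exact one_div_le_one_div_of_le (by positivity) (pow_le_pow_right₀ h1 (Nat.mul_le_mul_right _ hmm))

/-- `1 < ℓ₂` (Mathlib's `liouvilleNumber 2 = Σ_{k ≥ 0} 2^{−k!} = 1/2 + 1/2 + 1/4 + 1/64 + … ≈ 1.2656`). -/
private theorem one_lt_ell2 : 1 < liouvilleNumber 2 := by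
  have h := partialSum_add_remainder (by norm_num : (1 : ℝ) < 2) 1
  have hp : partialSum 2 1 = 1 := by
    simp [partialSum, Finset.sum_range_succ]; norm_num
  have hr := remainder_pos (by norm_num : (1 : ℝ) < 2) 1
  linarith

/-- `s_2 = 5/4`. -/
private theorem partialSum_two_two : partialSum 2 2 = 5 / 4 := by
  simp [partialSum, Finset.sum_range_succ, Nat.factorial]; norm_num

/-- `5/4 ≤ s_N` for `N ≥ 2`. -/
private theorem five_fourths_le_partialSum {N : ℕ} (hN : 2 ≤ N) : 5 / 4 ≤ partialSum 2 N := by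
  rw [← partialSum_two_two]; exact partialSum_two_strictMono.monotone hN

/-- `ℓ₂ < 41/32`. -/
private theorem ell2_lt : liouvilleNumber 2 < 41 / 32 := by
  have h := abs_liouvilleNumber_two_sub_partialSum 2
  rw [partialSum_two_two] at h
  have h' := (abs_lt.mp h).2
  norm_num [Nat.factorial] at h'
  linarith

/-- `p_N = 2^{N!} s_N` as reals. -/
private theorem psNumer_two_cast (N : ℕ) : (psNumer 2 N : ℝ) = 2 ^ N ! * partialSum 2 N := by
  have := partialSum_eq_psNumer_div (by norm_num : 0 < 2) N
  push_cast at this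
  rw [this]; field_simp

/-- `2^{N!} < p_N` for `N ≥ 2` (`s_N > 1`). -/
private theorem two_pow_lt_psNumer {N : ℕ} (hN : 2 ≤ N) : 2 ^ N ! < psNumer 2 N := by
  have h := psNumer_two_cast N
  have hs := five_fourths_le_partialSum hN
  have hpos : (0 : ℝ) < 2 ^ N ! := by positivity
  have : ((2 ^ N ! : ℕ) : ℝ) < (psNumer 2 N : ℝ) := by rw [h]; push_cast; nlinarith
  exact_mod_cast this

/-- **`u⋆ := 1/(ℓ₂ − 1)`** — the `m = 1` ceiling witness. -/
noncomputable def uStar : ℝ := 1 / (liouvilleNumber 2 - 1)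

/-- denominator of the `N`-th approximant of `u⋆`: `d_N := p_N − 2^{N!} = 2^{N!}(s_N − 1)` (odd). -/
def dU (N : ℕ) : ℕ := psNumer 2 N - 2 ^ N !

/-- the `N`-th approximant `1/(s_N − 1) = 2^{N!}/d_N`. -/
def rU (N : ℕ) : ℚ := ((2 ^ N ! : ℕ) : ℚ) / (dU N : ℚ)

/-- `d_N = 2^{N!}(s_N − 1)` as reals. -/
theorem dU_cast {N : ℕ} (hN : 2 ≤ N) : (dU N : ℝ) = 2 ^ N ! * (partialSum 2 N - 1) := by
  unfold dU
  rw [Nat.cast_sub (two_pow_lt_psNumer hN).le, psNumer_two_cast]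
  push_cast; ring

/-- `2^{N!} ≤ 4 d_N`. -/
theorem two_pow_le_four_mul_dU {N : ℕ} (hN : 2 ≤ N) : 2 ^ N ! ≤ 4 * dU N := by
  have h := dU_cast hN
  have hs := five_fourths_le_partialSum hN
  have hpos : (0 : ℝ) < 2 ^ N ! := by positivity
  have : ((2 ^ N ! : ℕ) : ℝ) ≤ ((4 * dU N : ℕ) : ℝ) := by push_cast; rw [h]; nlinarith
  exact_mod_cast this

/-- `2 d_N < 2^{N!}`. -/
theorem two_mul_dU_lt {N : ℕ} (hN : 2 ≤ N) : 2 * dU N < 2 ^ N ! := by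
  have h := dU_cast hN
  have hs : partialSum 2 N < 41 / 32 := (partialSum_two_lt_liouvilleNumber N).trans ell2_lt
  have hpos : (0 : ℝ) < 2 ^ N ! := by positivity
  have : ((2 * dU N : ℕ) : ℝ) < ((2 ^ N ! : ℕ) : ℝ) := by push_cast; rw [h]; nlinarith
  exact_mod_cast this

/-- `1 ≤ d_N`. -/
theorem one_le_dU {N : ℕ} (hN : 2 ≤ N) : 1 ≤ dU N := by
  have := two_pow_le_four_mul_dU hN
  have h1 : 1 ≤ 2 ^ N ! := Nat.one_le_two_pow
  omega

/-- EXACT denominator: `den(r_N) = d_N` (`d_N` odd, coprime to `2^{N!}`). -/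
theorem rU_den {N : ℕ} (hN : 2 ≤ N) : (rU N).den = dU N := by
  have hodd_p : Odd (psNumer 2 N) := Nat.coprime_two_right.mp (coprime_psNumer 2 hN)
  have heven : Even (2 ^ N !) := (Nat.even_pow' (Nat.factorial_pos N).ne').mpr even_two
  have hodd : Odd (dU N) := Nat.Odd.sub_even (two_pow_lt_psNumer hN).le hodd_p heven
  have hcop : Nat.Coprime (((2 ^ N ! : ℕ) : ℤ)).natAbs ((dU N : ℤ)).natAbs := by
    rw [Int.natAbs_natCast, Int.natAbs_natCast]
    exact (Nat.coprime_two_left.mpr hodd).pow_left _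
  have hpos : (0 : ℤ) < (dU N : ℤ) := by exact_mod_cast (one_le_dU hN)
  have h := Rat.den_div_eq_of_coprime hpos hcop
  have e : (((2 ^ N ! : ℕ) : ℤ) : ℚ) / ((dU N : ℤ) : ℚ) = rU N := by simp [rU]
  rw [e] at h
  exact_mod_cast h

/-- `r_N = 1/(s_N − 1)` as a real. -/
theorem rU_cast {N : ℕ} (hN : 2 ≤ N) : ((rU N : ℚ) : ℝ) = 1 / (partialSum 2 N - 1) := by
  have hd := dU_cast hN
  have hs1 : partialSum 2 N - 1 ≠ 0 := by have := five_fourths_le_partialSum hN; linarith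
  have hpos : (2 : ℝ) ^ N ! ≠ 0 := by positivity
  unfold rU; push_cast; rw [hd]; field_simp

/-- `|u⋆ − r_N| < 32 · 2^{−(N+1)!}` and `u⋆ ≠ r_N`. -/
theorem uStar_sub_rU {N : ℕ} (hN : 2 ≤ N) :
    |uStar - (rU N : ℝ)| < 32 / 2 ^ (N + 1)! ∧ uStar ≠ (rU N : ℝ) := by
  rw [rU_cast hN]
  have hs := five_fourths_le_partialSum hN
  have hsl := partialSum_two_lt_liouvilleNumber N
  have hl2 : 5 / 4 < liouvilleNumber 2 := lt_of_le_of_lt hs hsl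
  have htail := abs_liouvilleNumber_two_sub_partialSum N
  rw [abs_lt] at htail
  have hA : 0 < liouvilleNumber 2 - 1 := by linarith
  have hB : 0 < partialSum 2 N - 1 := by linarith
  have hAB : 0 < (liouvilleNumber 2 - 1) * (partialSum 2 N - 1) := mul_pos hA hB
  have e : uStar - 1 / (partialSum 2 N - 1) =
      (partialSum 2 N - liouvilleNumber 2) / ((liouvilleNumber 2 - 1) * (partialSum 2 N - 1)) := by
    unfold uStar; field_simp; ring
  rw [e]
  have hprod : 1 / 16 ≤ (liouvilleNumber 2 - 1) * (partialSum 2 N - 1) := by nlinarith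
  constructor
  · rw [abs_div, abs_of_pos hAB, abs_of_neg (by linarith), div_lt_iff₀ hAB]
    have h32 : (0 : ℝ) < 32 / 2 ^ (N + 1)! := by positivity
    have hm := mul_le_mul_of_nonneg_left hprod h32.le
    have e2 : (32 : ℝ) / 2 ^ (N + 1)! * (1 / 16) = 2 / 2 ^ (N + 1)! := by ring
    linarith [htail.2]
  · intro h0
    have h1 : (partialSum 2 N - liouvilleNumber 2) / ((liouvilleNumber 2 - 1) * (partialSum 2 N - 1)) = 0 := by
      rw [← e, h0, sub_self]
    rw [div_eq_zero_iff] at h1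
    rcases h1 with h1 | h1
    · linarith
    · exact hAB.ne' h1

/-- **`u⋆ ∈ Skel₍₁₎`**: along `r_N = 2^{N!}/d_N` one has `den = d_N ≤ 2^{N!}`, so `ι(den) ≤ N`, and
`|u⋆ − r_N| < 32·2^{−(N+1)!} ≤ d_N^{−N} ≤ den^{−ι(den)}`. -/
theorem skelLiouvilleFix_one_uStar : SkelLiouvilleFix 1 uStar := by
  intro q₀
  set N : ℕ := q₀ + 5 with hNdef
  have hN2 : 2 ≤ N := by omega
  have hN5 : 5 ≤ N := by omega
  have hd1 := one_le_dU hN2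
  have h4d := two_pow_le_four_mul_dU hN2
  have h2d := two_mul_dU_lt hN2
  refine ⟨rU N, ?_, (uStar_sub_rU hN2).2, ?_⟩
  · rw [rU_den hN2]
    have h2 : 2 ^ N ≤ 2 ^ N ! := Nat.pow_le_pow_right two_pos (Nat.self_le_factorial N)
    have h3 : 2 ^ N = 32 * 2 ^ q₀ := by rw [hNdef, pow_add]; ring
    have h4 : q₀ < 2 ^ q₀ := Nat.lt_two_pow_self
    omega
  · rw [rU_den hN2, one_mul]
    refine (uStar_sub_rU hN2).1.trans_le ?_
    have hι : iota (dU N) ≤ N := iota_le_of_le (by omega)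
    have hdR : (1 : ℝ) ≤ dU N := by exact_mod_cast hd1
    have hpowle : (dU N : ℝ) ^ iota (dU N) ≤ (dU N : ℝ) ^ N := pow_le_pow_right₀ hdR hι
    have h2dR : 2 * (dU N : ℝ) ≤ 2 ^ N ! := by exact_mod_cast h2d.le
    have h1 : (2 * (dU N : ℝ)) ^ N ≤ ((2 : ℝ) ^ N !) ^ N := pow_le_pow_left₀ (by positivity) h2dR N
    rw [mul_pow, ← pow_mul] at h1
    have h32 : (32 : ℝ) ≤ 2 ^ N := by
      calc (32 : ℝ) = 2 ^ 5 := by norm_num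
        _ ≤ 2 ^ N := pow_le_pow_right₀ (by norm_num) hN5
    have hexp : (2 : ℝ) ^ (N ! * N) ≤ 2 ^ (N + 1)! :=
      pow_le_pow_right₀ (by norm_num) (by rw [Nat.factorial_succ, mul_comm]; exact Nat.mul_le_mul_right _ (Nat.le_succ N))
    have hdN : (0 : ℝ) ≤ (dU N : ℝ) ^ N := by positivity
    have key : 32 * (dU N : ℝ) ^ N ≤ 2 ^ (N + 1)! := by nlinarith
    calc (32 : ℝ) / 2 ^ (N + 1)! ≤ 1 / (dU N : ℝ) ^ N := by
          rw [div_le_div_iff₀ (by positivity) (by positivity)]; linarith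
      _ ≤ 1 / (dU N : ℝ) ^ iota (dU N) := one_div_le_one_div_of_le (by positivity) hpowle

/-- `(ℓ₂, u⋆)` is ℚ-linearly independent (`ℓ₂` is transcendental, so no `s ℓ₂² − s ℓ₂ + t = 0`). -/
theorem linearIndependent_ell2_uStar :
    LinearIndependent ℚ ![((liouvilleNumber 2 : ℝ) : ℂ), (uStar : ℂ)] := by
  have hT : Transcendental ℚ ((liouvilleNumber 2 : ℝ) : ℂ) :=
    transcendental_ofReal_of_liouville (liouville_liouvilleNumber (le_refl 2))
  rw [transcendental_iff] at hT
  rw [LinearIndependent.pair_iff]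
  intro s t hst
  set x : ℂ := ((liouvilleNumber 2 : ℝ) : ℂ) with hx
  have hx1 : x - 1 ≠ 0 := by
    rw [hx, sub_ne_zero]
    intro h
    have h1 : liouvilleNumber 2 = 1 := by exact_mod_cast h
    linarith [one_lt_ell2]
  have hu : ((uStar : ℝ) : ℂ) = 1 / (x - 1) := by simp [uStar, hx]
  have hu0 : ((uStar : ℝ) : ℂ) ≠ 0 := by rw [hu]; exact div_ne_zero one_ne_zero hx1
  have h0 : (s : ℂ) * x + (t : ℂ) * ((uStar : ℝ) : ℂ) = 0 := by
    simpa [Rat.smul_def] using hst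
  by_cases hs : s = 0
  · refine ⟨hs, ?_⟩
    rw [hs, Rat.cast_zero, zero_mul, zero_add] at h0
    exact_mod_cast (mul_eq_zero.mp h0).resolve_right hu0
  · exfalso
    have hrel : (s : ℂ) * x ^ 2 + ((-s : ℚ) : ℂ) * x + (t : ℂ) = 0 := by
      rw [hu] at h0
      field_simp at h0
      push_cast
      linear_combination h0
    set p : Polynomial ℚ := Polynomial.C s * Polynomial.X ^ 2 + Polynomial.C (-s) * Polynomial.X +
      Polynomial.C t with hp
    have hp0 : p ≠ 0 := by
      intro h
      have hl := Polynomial.leadingCoeff_quadratic (b := -s) (c := t) hs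
      rw [← hp, h, Polynomial.leadingCoeff_zero] at hl
      exact hs hl.symm
    have hval : Polynomial.aeval x p = 0 := by
      rw [hp]
      simp only [map_add, map_mul, map_pow, Polynomial.aeval_C, Polynomial.aeval_X, eq_ratCast]
      exact hrel
    exact hp0 (hT p hval)

/-- `(ℓ₂, u⋆)` is algebraically DEPENDENT: `ℓ₂ u⋆ − u⋆ − 1 = 0`. -/
theorem not_algebraicIndependent_ell2_uStar :
    ¬ AlgebraicIndependent ℚ ![((liouvilleNumber 2 : ℝ) : ℂ), (uStar : ℂ)] := by
  rw [algebraicIndependent_iff]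
  intro h
  set x : ℂ := ((liouvilleNumber 2 : ℝ) : ℂ) with hx
  have hx1 : x - 1 ≠ 0 := by
    rw [hx, sub_ne_zero]
    intro h1
    have h2 : liouvilleNumber 2 = 1 := by exact_mod_cast h1
    linarith [one_lt_ell2]
  have hu : ((uStar : ℝ) : ℂ) = 1 / (x - 1) := by simp [uStar, hx]
  set P : MvPolynomial (Fin 2) ℚ := MvPolynomial.X 0 * MvPolynomial.X 1 - MvPolynomial.X 1 - 1 with hP
  have hval : MvPolynomial.aeval ![x, ((uStar : ℝ) : ℂ)] P = 0 := by
    simp only [hP, map_sub, map_mul, MvPolynomial.aeval_X, map_one, Matrix.cons_val_zero,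
      Matrix.cons_val_one]
    rw [hu]
    field_simp
    ring
  have hP0 := h P hval
  have hcc : MvPolynomial.constantCoeff P = -1 := by
    simp [hP, MvPolynomial.constantCoeff_X]
  rw [hP0, map_zero] at hcc
  norm_num at hcc

/-- **THE `m = 1` CEILING (tightness lemma; honesty equipment — no credit).**  `u⋆ = 1/(ℓ₂ − 1)` is
Skel-Liouville at the FIXED multiple `m = 1` (`den^{−1·ι(den)}`), the pair `(ℓ₂, u⋆)` is ℚ-free with a Liouville
coordinate — so `z = (ℓ₂, u⋆)` MEETS the hypotheses of item 31077 — and yet `(ℓ₂, u⋆)` is algebraically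
DEPENDENT: the conclusion of the engine (`algebraicIndependent_ell2_of_skelLiouville`) FAILS on `Skel₍₁₎`, i.e. no
class `den^{−m·ι(den)}` with a fixed multiple `m ≤ 1` carries the pair cell by the a.i. method.  RECORD (not
silently replaced): g42's first witness `1/ℓ₂` with approximants `2^{N!}/p_N` narrowly FAILS membership along that
sequence — there `den = p_N > 2^{N!}` forces `ι(p_N) = N + 1` and `|1/ℓ₂ − 2^{N!}/p_N| ≈ 2ℓ₂^{−2}·2^{−(N+1)!}` is
NOT `< p_N^{−(N+1)} = s_N^{−(N+1)}·2^{−(N+1)!}` (`s_N ≈ 1.27`); the corrected witness moves the denominator BELOW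
the radix power (`d_N = p_N − 2^{N!} < 2^{N!}/2`, `ι = N`).  OPEN: whether a FIXED multiple `m ≥ 2` already lies
inside the a.i. regime (`∀ ρ ∈ Skel₍₂₎`, `(ℓ₂, ρ)` a.i.?) — the engine of §2–§3 consumes `m → ∞`. -/
theorem skel_fixedOne_ceiling :
    SkelLiouvilleFix 1 uStar ∧
    LinearIndependent ℚ ![((liouvilleNumber 2 : ℝ) : ℂ), (uStar : ℂ)] ∧
    (∃ w ∈ Submodule.span ℚ (Set.range ![((liouvilleNumber 2 : ℝ) : ℂ), (uStar : ℂ)]),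
      Liouville w.re ∨ Liouville w.im) ∧
    ¬ AlgebraicIndependent ℚ ![((liouvilleNumber 2 : ℝ) : ℂ), (uStar : ℂ)] := by
  have hℓ : Liouville (liouvilleNumber 2) := liouville_liouvilleNumber (le_refl 2)
  exact ⟨skelLiouvilleFix_one_uStar, linearIndependent_ell2_uStar,
    ⟨_, Submodule.subset_span ⟨0, rfl⟩, Or.inl (by simpa using hℓ)⟩, not_algebraicIndependent_ell2_uStar⟩

/-- The ceiling as a negation: the a.i. conclusion of the engine does NOT extend to the fixed class `m = 1`. -/
theorem not_skelFixOne_algebraicIndependent :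
    ¬ ∀ ρ : ℝ, SkelLiouvilleFix 1 ρ → AlgebraicIndependent ℚ ![((liouvilleNumber 2 : ℝ) : ℂ), (ρ : ℂ)] :=
  fun h => not_algebraicIndependent_ell2_uStar (h _ skelLiouvilleFix_one_uStar)

/-- … while on the whole intersection `Skel = ⋂ₘ Skel₍ₘ₎` it holds (restated from §7b for contrast). -/
theorem skel_algebraicIndependent (ρ : ℝ) (hρ : ∀ m, SkelLiouvilleFix m ρ) :
    AlgebraicIndependent ℚ ![((liouvilleNumber 2 : ℝ) : ℂ), (ρ : ℂ)] :=
  algebraicIndependent_ell2_of_skelLiouville ((skelLiouville_iff_fix ρ).mpr hρ)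

end Ceiling

end Summit.Schanuel.Schanuel.Theorems.RootDecomp1KSkelCell
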